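import Summits.CriticalPhenomena.PercolationContinuityZ3.Theorems.PercNearOneGluingNoHeavyLowerTailSahiC4CubeFive
import Summits.CriticalPhenomena.PercolationContinuityZ3.Theorems.PercNearOneGluingNoHeavyLowerTailSahiC3CubeAnyIndex
import Summits.CriticalPhenomena.PercolationContinuityZ3.Theorems.PercNearOneGluingNoHeavyLowerTailSahiConjectureCubeFour
import Summits.CriticalPhenomena.PercolationContinuityZ3.Theorems.PercNearOneGluingNoHeavyLowerTailSahiCubeFiveAllOrders

/-!
# Sahi's `C₃` and `C₄` under product measures on ANY index set with at most five coordinates, increasing and decreasing events;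
# `C_n(μ_p)`, `n ≤ 4`, in function form on at most five coins

Support file (cell `prim-sahi`, seat `prim-sahi-typer` gen 28; `--supports stmt-CriticalPhenomena-4575`).  Pure proofs; the closure is COMPUTATIONAL
through `SahiC3Cube.sahiC3_cube_five` and `SahiC4Cube.sahiC4_cube_five` (`native_decide` chunks).  Transport of the two `Fin 5` theorems along a
bijection `Fin 5 ≃ ι` (`SahiC3Cube.sahiE3_relabel`, `SahiHereditaryMeetAbsorption.sahiE4_relabel`), along complementation `ω ↦ ωᶜ` (which turns `P_p` into `P_{1−p}` and
down-sets into up-sets: `sahiE3_compl`, `SahiHereditaryMeetAbsorption.sahiE4_reflect`), and — for the function form — along the lattice isomorphism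
`Equiv.Set.congr` (`NCopyCert.bernoulliWeight_eq_pushWeight_congr`, …`SahiConjectureCubeFour`); the `≤ 4` cases are the tree's:

* `sahiC3_of_card_le_five`, `sahiC4_of_card_le_five` — any `Fintype ι` with `card ι ≤ 5`, any `q : ι → [0,1]`, increasing `A, B, C(, D) ⊆ Set ι`:
  `0 ≤ E₃(A,B,C)` and `0 ≤ E₄(A,B,C,D)` under `prodBernoulli q` — Kahn's Conjecture 5 [Kahn 2022] and Sahi's Conjecture 5 at orders `3, 4`
  [Sahi 2008] for every product measure on at most five coordinates;
* `sahiC3_lower_of_card_le_five`, `sahiC4_lower_of_card_le_five` — the same for DECREASING events (e.g. disconnection events of a graph with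
  at most five edges);
* `sahiPositive_bernoulliWeight_of_card_le_five` — `SahiPositive (bernoulliWeight q) n` for every `n ≤ 4` (all nonnegative increasing
  `f₁, …, f_n` on `2^ι`, `|ι| ≤ 5`); `sahiPositive_bernoulliWeightDual_of_card_le_five`, `sahiE_ind_nonneg_of_isLowerSet_card_le_five` — the order dual;
* `sahiPositive_bernoulliWeight_all_fin_five_of_cores'` — ALL orders on five coins from the six coloured-antichain conditions of orders `5, …, 10`
  (`SahiCubeFive.sahiPositive_bernoulliWeight_all_fin_five_of_cores` with its hypothesis `h4` discharged by `sahiPositive_bernoulliWeight_fin_five_of_le_four`;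
  the six conditions are a census outside Lean, typer gen 28 memo §6).
[this work]
-/

namespace Summit.CriticalPhenomena.PercolationContinuityZ3.Theorems.SahiC4Cube

open MeasureTheory SahiC3Cube
open Literature.Combinatorics.Sahi2008
open Literature.Probability.Percolation
open Literature.Probability.LatticeModels (prodBernoulli sahiE3 sahiE4 sahiE4_def prodBernoulli_map_compl isUpperSet_preimage_compl)
open Literature.Probability.Percolation.DecisionTree (ind ind_nonneg)

variable {ι ι' : Type*}

/-! ## `C₃` on at most five coordinates -/

/-- **`C₃` on `{0,1}^m`, `m ≤ 5`, every product measure** (`m ≤ 3` kernel, `m = 4, 5` computational). [this work] -/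
theorem sahiC3_cube_le_five {m : ℕ} (hm : m ≤ 5) (p : Fin m → unitInterval) {A B C : Set (Set (Fin m))} (hA : IsUpperSet A)
    (hB : IsUpperSet B) (hC : IsUpperSet C) : 0 ≤ sahiE3 (prodBernoulli p) A B C := by
  rcases Nat.lt_or_ge m 5 with h | h
  · exact sahiC3_cube_le_four (by omega) p hA hB hC
  · obtain rfl : m = 5 := le_antisymm hm h
    exact sahiC3_cube_five p hA hB hC

/-- **Kahn's Conjecture 5 / Sahi's `C₃` for every product measure on at most five coordinates** (any index type). [this work] -/
theorem sahiC3_of_card_le_five [Fintype ι] (hι : Fintype.card ι ≤ 5) (q : ι → unitInterval) {A B C : Set (Set ι)}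
    (hA : IsUpperSet A) (hB : IsUpperSet B) (hC : IsUpperSet C) : 0 ≤ sahiE3 (prodBernoulli q) A B C := by
  let e : Fin (Fintype.card ι) ≃ ι := (Fintype.equivFin ι).symm
  rw [sahiE3_relabel e (fun i => q (e i)) q (fun _ => rfl)]
  exact sahiC3_cube_le_five hι _ (isUpperSet_preimage_relabel e hA) (isUpperSet_preimage_relabel e hB)
    (isUpperSet_preimage_relabel e hC)

/-- **`C₃` for DECREASING events, every product measure on at most five coordinates.** [this work] -/
theorem sahiC3_lower_of_card_le_five [Fintype ι] (hι : Fintype.card ι ≤ 5) (q : ι → unitInterval) {A B C : Set (Set ι)}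
    (hA : IsLowerSet A) (hB : IsLowerSet B) (hC : IsLowerSet C) : 0 ≤ sahiE3 (prodBernoulli q) A B C := by
  rw [sahiE3_compl]
  exact sahiC3_of_card_le_five hι _ (isUpperSet_preimage_compl hA) (isUpperSet_preimage_compl hB)
    (isUpperSet_preimage_compl hC)

/-! ## `C₄` on at most five coordinates -/

/-- **`C₄` on `{0,1}^m`, `m ≤ 5`, every product measure** (`m ≤ 3` kernel, `m = 4, 5` computational). [this work] -/
theorem sahiC4_cube_le_five {m : ℕ} (hm : m ≤ 5) (p : Fin m → unitInterval) {A B C D : Set (Set (Fin m))} (hA : IsUpperSet A)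
    (hB : IsUpperSet B) (hC : IsUpperSet C) (hD : IsUpperSet D) : 0 ≤ sahiE4 (prodBernoulli p) A B C D := by
  rcases Nat.lt_or_ge m 5 with h | h
  · exact SahiHereditaryMeetAbsorption.sahiC4_cube_le_four (by omega) p hA hB hC hD
  · obtain rfl : m = 5 := le_antisymm hm h
    exact sahiC4_cube_five p hA hB hC hD

/-- **Sahi's `C₄` for every product measure on at most five coordinates** (any index type). [this work] -/
theorem sahiC4_of_card_le_five [Fintype ι] (hι : Fintype.card ι ≤ 5) (q : ι → unitInterval) {A B C D : Set (Set ι)}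
    (hA : IsUpperSet A) (hB : IsUpperSet B) (hC : IsUpperSet C) (hD : IsUpperSet D) : 0 ≤ sahiE4 (prodBernoulli q) A B C D := by
  let e : Fin (Fintype.card ι) ≃ ι := (Fintype.equivFin ι).symm
  rw [SahiHereditaryMeetAbsorption.sahiE4_relabel e (fun i => q (e i)) q (fun _ => rfl)]
  exact sahiC4_cube_le_five hι _ (isUpperSet_preimage_relabel e hA) (isUpperSet_preimage_relabel e hB)
    (isUpperSet_preimage_relabel e hC) (isUpperSet_preimage_relabel e hD)

/-- **`C₄` for DECREASING events, every product measure on at most five coordinates.** [this work] -/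
theorem sahiC4_lower_of_card_le_five [Fintype ι] (hι : Fintype.card ι ≤ 5) (q : ι → unitInterval) {A B C D : Set (Set ι)}
    (hA : IsLowerSet A) (hB : IsLowerSet B) (hC : IsLowerSet C) (hD : IsLowerSet D) : 0 ≤ sahiE4 (prodBernoulli q) A B C D := by
  rw [SahiHereditaryMeetAbsorption.sahiE4_reflect]
  exact sahiC4_of_card_le_five hι _ (isUpperSet_preimage_compl hA) (isUpperSet_preimage_compl hB)
    (isUpperSet_preimage_compl hC) (isUpperSet_preimage_compl hD)

/-! ## Function form: `C_n(μ_q)` for `n ≤ 4` on at most five coins -/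

/-- **`SahiPositive (bernoulliWeight q) n` for every `n ≤ 4` and every product weight on at most five coordinates** (all nonnegative increasing
`f₁, …, f_n : 2^ι → ℝ`; at most four coordinates: every `n`, `NCopyCert.sahiPositive_bernoulliWeight_of_card_le_four`). [this work] -/
theorem sahiPositive_bernoulliWeight_of_card_le_five [Fintype ι] (hι : Fintype.card ι ≤ 5) (q : ι → unitInterval) {n : ℕ}
    (hn : n ≤ 4) : SahiPositive (bernoulliWeight q) n := by
  classical
  rcases Nat.lt_or_ge (Fintype.card ι) 5 with h | h
  · exact NCopyCert.sahiPositive_bernoulliWeight_of_card_le_four (by omega) q n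
  · have hcard : Fintype.card ι = 5 := le_antisymm hι h
    let e : Fin 5 ≃ ι := (finCongr hcard).symm.trans (Fintype.equivFin ι).symm
    rw [NCopyCert.bernoulliWeight_eq_pushWeight_congr e q]
    exact (sahiPositive_bernoulliWeight_fin_five_of_le_four _ hn).of_pushWeight fun s t hst => Set.image_mono hst

/-- **The order dual**: the dual product weight on `(Set ι)ᵒᵈ`, `|ι| ≤ 5` (under which DECREASING events are increasing), is Sahi-positive of
every order `n ≤ 4`. [this work] -/
theorem sahiPositive_bernoulliWeightDual_of_card_le_five [Fintype ι] (hι : Fintype.card ι ≤ 5) (q : ι → unitInterval) {n : ℕ}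
    (hn : n ≤ 4) : SahiPositive (bernoulliWeightDual q) n := by
  rw [NCopyCert.bernoulliWeightDual_eq_pushWeight_compl]
  exact (sahiPositive_bernoulliWeight_of_card_le_five hι _ hn).of_pushWeight (OrderIso.compl (Set ι)).monotone

/-- **Decreasing events, orders `≤ 4`, at most five coordinates**: `E_n(1_{A_1},…,1_{A_n}) ≥ 0` for any `n ≤ 4` decreasing events
(repetitions allowed). [this work] -/
theorem sahiE_ind_nonneg_of_isLowerSet_card_le_five [Fintype ι] (hι : Fintype.card ι ≤ 5) (q : ι → unitInterval) {n : ℕ}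
    (hn : n ≤ 4) (A : Fin n → Set (Set ι)) (hA : ∀ i, IsLowerSet (A i)) :
    0 ≤ sahiE (bernoulliWeight q) n (fun i => ind (A i)) := by
  have key := sahiPositive_bernoulliWeightDual_of_card_le_five hι q hn (fun i (a : (Set ι)ᵒᵈ) => ind (A i) (OrderDual.ofDual a))
    (fun _ _ => ind_nonneg _ _) (fun i => monotone_ind_toDual_of_isLowerSet (hA i))
  exact key

/-- **Increasing events, orders `≤ 4`, at most five coordinates**: `E_n(1_{A_1},…,1_{A_n}) ≥ 0` for any `n ≤ 4` increasing events. [this work] -/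
theorem sahiE_ind_nonneg_of_isUpperSet_card_le_five [Fintype ι] (hι : Fintype.card ι ≤ 5) (q : ι → unitInterval) {n : ℕ}
    (hn : n ≤ 4) (A : Fin n → Set (Set ι)) (hA : ∀ i, IsUpperSet (A i)) :
    0 ≤ sahiE (bernoulliWeight q) n (fun i => ind (A i)) :=
  sahiPositive_bernoulliWeight_of_card_le_five hι q hn _ (fun _ _ => ind_nonneg _ _) (fun i => monotone_ind_of_isUpperSet (hA i))

/-! ## All orders on five coins, modulo the coloured cores of orders `5, …, 10` -/

open scoped Classical in
/-- **Sahi's conjecture at EVERY order for every product measure on `2^{Fin 5}`, given the six finite coloured-antichain conditions** (orders `≤ 4`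
discharged by `sahiC3_cube_five` / `sahiC4_cube_five`; width collapse and surjective-colouring reduction from …`SahiCubeFiveAllOrders`). [this work] -/
theorem sahiPositive_bernoulliWeight_all_fin_five_of_cores' (p : Fin 5 → unitInterval)
    (hcore : ∀ n : ℕ, 3 ≤ n → n ≤ 8 → ∀ (N : Finset (Set (Fin 5))) (c : Set (Fin 5) → Fin (n + 2)),
      IsAntichain (· ≤ ·) (N : Set (Set (Fin 5))) → (∀ i : Fin (n + 2), ∃ T ∈ N, c T = i) →
      0 ≤ sahiE (bernoulliWeight p) (n + 2) (fun i => setInd (Finset.univ.filter fun q : Set (Fin 5) => ∀ T ∈ N, c T = i → ¬ q ≤ T))) :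
    ∀ n, SahiPositive (bernoulliWeight p) n :=
  SahiCubeFive.sahiPositive_bernoulliWeight_all_fin_five_of_cores p (fun _ hn => sahiPositive_bernoulliWeight_fin_five_of_le_four p hn) hcore

end Summit.CriticalPhenomena.PercolationContinuityZ3.Theorems.SahiC4Cube
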